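import Summits.QuantumFields.BalabanUV.Beta.EriceFlowEnclosureInverseLawFourthStep

/-!
# Beta / EriceFlowEnclosureInverseLawFourth — INVERSION OF A LOGARITHMIC LAW TO FOURTH ORDER (pure real analysis, SERVICE): if the
# Λ-coordinate obeys `Λ t = 1∕t + κ·log t + C + a·t + b·t² + O(t³)` at 0⁺ and σ is its eventual right inverse with σ → 0⁺ and y·σ y → 1,
# then THE INVERSE LAW TO ORDER 1∕y²:
#   1∕σ y = y + κ·log y − C + κ²·(log y)∕y − (κC + a)∕y + Q(log y)∕y² + O((1 + log y)³∕y³),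
#   Q(ℓ) = −(κ³∕2)·ℓ² + (κ³ + κ²C + κa)·ℓ − (κC²∕2 + κ²C + κa + aC + b)
# — the next term of P2 #36c `inverse_law_third` (which stopped at −(κC + a)∕y + O((1 + log y)²∕y²)); the 1∕y² letter is a QUADRATIC
# POLYNOMIAL IN log y whose leading coefficient −κ³∕2 does not see a, b at all, whose log-coefficient sees a but not b, and whose constant
# is the only place the Λ-law's O(t²) letter b enters (with a minus sign) (β-flow team, prover 2 = lower ∕ positivity side, unit
# `b2b-balaban-beta-bflow-p2`, gen 20; module P2 #36e; companions P2 #36 `…InverseLawRate`, P2 #36c `…InverseLawThird` (one order less,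
# same letters E, u, r and the same device), P2 #36b ∕ #36d `…RunningCouplingRate ∕ …RunningCouplingThird` (the running coupling fed by
# bflow-p1's Λ-laws #42 ∕ #45c); WRITTEN FOR bflow-p1 g17's announced #45f `lambda_fourLoop_rate` (the Λ-law to O(t²) with letter b_Λ under
# (L) + (T₄), INTENT [BFLOW-P1-G17-INTENT45E] l.42883: «the running coupling's O(1∕y²) letter via a deeper inverse law is yours if wanted»)
# — this file takes that law as a HYPOTHESIS SHAPE and inverts it; NOTHING of #45f is assumed or restated)

HONEST FRAMING (page 1 of everything the β sub-cell writes): discharging `BetaPertH` makes Bałaban's UV stability UNCONDITIONAL — a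
real constructive-QFT result; it is NOT the continuum limit and NOT the Clay problem.  HONEST DEPENDENCY (cell reorg 2026-08-19,
verbatim): «continuum YM on T⁴ ⇐ BetaPertH ∧ nine spine estimates (0/9 proved); BetaPertH ⇐ (D1) ∧ (D4) ∧ CAP+tail; G-an2-4 gates
asym, D1 and NE2/3/4.»  THIS MODULE DISCHARGES NOTHING: [folklore] real analysis of one real function and its right inverse
(`log x ≤ x − 1`, Mathlib's `Real.abs_log_sub_add_sum_range_le` at n = 2 for `|u + u²∕2 + log(1 − u)| ≤ 2|u|³`, P2 #36c
`abs_log_sub_le_of_inv_eq`); no Erice sentence is consumed; «Λ-parameter» ∕ «running coupling» ∕ «four-loop» are bflow-p1's READINGS of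
(3.76) («+ O(1)», p. 250 — nothing finer in print); κ, C, a, b are ABSTRACT letters here (at the β-flow they read κ = β₂∕β₀, C = C_Λ,
a = a_Λ = β₃∕β₀ − β₂²∕β₀² + β₂∕2 (#45c), b = b_Λ (#45f, announced) — OUR letters, none printed).

WHAT THIS FILE PROVES (0 sorry, 0 def; the exact identity `inverse_fourth_identity`, the two remainder bounds and the third-order log
lemma live in P2 #36e-A `…InverseLawFourthStep`): `quadLog_letters_eq_zero` ∕ **`invLetter2_unique`** ([folklore]: a quadratic polynomial
in log y that is O((1 + log y)³∕y) vanishes identically — the 1∕y² letter Q is FORCED by the function),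
HEADLINE **`inverse_law_fourth`** — hypotheses: `|Λ t − 1∕t − κ·log t − C − a·t − b·t²| ≤ A·t³` on ]0, t₁[ (A ≥ 0, t₁ > 0), `σ → 0⁺`,
`Λ (σ y) = y` eventually, `y·σ y → 1`; conclusion: `∃ A′ ≥ 0`, eventually
`|1∕σ y − y − κ·log y + C − κ²·(log y)∕y + (κC + a)∕y − Q(log y)∕y²| ≤ A′·(1 + log y)³∕y³` (A′ displayed in the proof: a polynomial in
|κ|, |C|, |a|, |b|, A).  THE POINT: at t = σ y write E := y − 1∕t − κ log t − C = a·t + b·t² + E₄ (|E₄| ≤ A t³ ≤ 8A∕y³),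
u := (C + κ log t + E)∕y so that 1∕(y t) = 1 − u EXACTLY, r := log(y t) − u = u²∕2 + r₃ (|r₃| ≤ 2|u|³), u₀ := (C − κ log y)∕y and
d := u − u₀ = (κu + κr + E)∕y EXACTLY (from log t = −log y + u + r); then
`TARGET = −κ²d∕y − κ²r∕y − κatu∕y − κbt²∕y − κE₄∕y − κu₀d − κd²∕2 − κr₃ − ad∕y − atu² − btu∕y − bt²u − E₄` is an exact identity (P2 #36e-A), and every term is
O((1 + log y)³∕y³) by |u|, |u₀| ≤ BL∕y, |r| ≤ 2B²L²∕y², |d| ≤ D₁L²∕y², |r₃| ≤ 2B³L³∕y³, t ≤ 2∕y, L := 1 + log y ≤ y.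
NOT CLAIMED: the Λ-law to O(t²) itself (a HYPOTHESIS here — bflow-p1's #45f when it lands); the size of A′ beyond the display; anything
about (1.22); `BetaPertH`; continuum; Clay.
-/

namespace Summit.QuantumFields.BalabanUV.Beta.EriceFlowEnclosureInverseLawFourth

open Set Filter Topology
open Summit.QuantumFields.BalabanUV.Beta.EriceFlowEnclosureInverseLawThird (abs_log_sub_le_of_inv_eq)
open Summit.QuantumFields.BalabanUV.Beta.EriceFlowEnclosureInverseLawFourthStep

noncomputable section

/-- **INVERSION TO FOURTH ORDER (pure real analysis): the 1∕y² letter is the quadratic polynomial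
Q(log y) = −(κ³∕2)·log²y + (κ³ + κ²C + κa)·log y − (κC²∕2 + κ²C + κa + aC + b).**  If
`|Λ t − 1∕t − κ·log t − C − a·t − b·t²| ≤ A·t³` on ]0, t₁[ (A ≥ 0, t₁ > 0), σ is an eventual right inverse of Λ with `σ y → 0⁺` and
`y·σ y → 1`, then for some A′ ≥ 0, eventually
`|1∕σ y − y − κ·log y + C − κ²·(log y)∕y + (κ·C + a)∕y − Q(log y)∕y²| ≤ A′·(1 + log y)³∕y³`.
Proof: the letters E, E₄, u, r, u₀, d, r₃ of the module docstring, `inverse_fourth_identity`, and the two remainder bounds with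
A₀ = 2|a| + 2|b| + 2A, B = |C| + |κ| + A₀, D₁ = |κ|B + |κ|B² + A₀ (so |E| ≤ A₀∕y, |u| ≤ B(1 + log y)∕y ≤ 1∕2 eventually, |d| ≤ D₁L²∕y²).
[folklore] -/
theorem inverse_law_fourth {Λ σ : ℝ → ℝ} {κ C a b A t₁ : ℝ} (hA : 0 ≤ A)
    (hlaw : ∀ t ∈ Ioo 0 t₁, |Λ t - 1 / t - κ * Real.log t - C - a * t - b * t ^ 2| ≤ A * t ^ 3)
    (hσ0 : Tendsto σ atTop (𝓝[>] 0)) (hσ : ∀ᶠ y in atTop, Λ (σ y) = y)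
    (hone : Tendsto (fun y => y * σ y) atTop (𝓝 1)) (ht₁ : 0 < t₁) :
    ∃ A' : ℝ, 0 ≤ A' ∧ ∀ᶠ y in atTop,
      |1 / σ y - y - κ * Real.log y + C - κ ^ 2 * Real.log y / y + (κ * C + a) / y
          - (-(κ ^ 3 / 2) * Real.log y ^ 2 + (κ ^ 3 + κ ^ 2 * C + κ * a) * Real.log y
              - (κ * C ^ 2 / 2 + κ ^ 2 * C + κ * a + a * C + b)) / y ^ 2|
        ≤ A' * (1 + Real.log y) ^ 3 / y ^ 3 := by
  have hmem : ∀ᶠ y in atTop, σ y ∈ Ioo 0 t₁ := hσ0 (Ioo_mem_nhdsGT ht₁)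
  have hlo : ∀ᶠ y in atTop, 1 / 2 < y * σ y := hone.eventually (lt_mem_nhds (by norm_num))
  have hhi : ∀ᶠ y in atTop, y * σ y < 2 := hone.eventually (gt_mem_nhds (by norm_num))
  obtain ⟨A₀, hA₀⟩ : ∃ A₀ : ℝ, A₀ = 2 * |a| + 2 * |b| + 2 * A := ⟨_, rfl⟩
  obtain ⟨B, hB⟩ : ∃ B : ℝ, B = |C| + |κ| + A₀ := ⟨_, rfl⟩
  obtain ⟨D₁, hD₁⟩ : ∃ D₁ : ℝ, D₁ = |κ| * B + |κ| * B ^ 2 + A₀ := ⟨_, rfl⟩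
  have hA₀nn : 0 ≤ A₀ := by rw [hA₀]; positivity
  have hB0 : 0 ≤ B := by rw [hB]; positivity
  have hD0 : 0 ≤ D₁ := by rw [hD₁]; positivity
  obtain ⟨K, hK⟩ : ∃ K : ℝ, K = (κ ^ 2 * D₁ + 2 * κ ^ 2 * B ^ 2 + 2 * |κ| * |a| * B + 4 * |κ| * |b| + 4 * |κ| * A
      + |κ| * B * D₁) + (|κ| * D₁ ^ 2 / 2 + 2 * |κ| * B ^ 3 + |a| * D₁ + 2 * |a| * B ^ 2 + 2 * |b| * B + 4 * |b| * B
      + 8 * A) := ⟨_, rfl⟩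
  have hsmallu : ∀ᶠ y : ℝ in atTop, B * (1 + Real.log y) / y ≤ 1 / 2 := by
    have hlogdiv : Tendsto (fun y : ℝ => Real.log y / y) atTop (𝓝 0) := Real.isLittleO_log_id_atTop.tendsto_div_nhds_zero
    have hinv : Tendsto (fun y : ℝ => 1 / y) atTop (𝓝 0) := tendsto_const_nhds.div_atTop tendsto_id
    have h : Tendsto (fun y : ℝ => B * (1 / y + Real.log y / y)) atTop (𝓝 0) := by
      have := (hinv.add hlogdiv).const_mul B; rwa [add_zero, mul_zero] at this
    have h2 := h.eventually (gt_mem_nhds (by norm_num : (0:ℝ) < 1 / 2))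
    filter_upwards [h2, eventually_gt_atTop (0:ℝ)] with y hy hy0
    have e : B * (1 + Real.log y) / y = B * (1 / y + Real.log y / y) := by field_simp
    rw [e]; exact hy.le
  refine ⟨K, by rw [hK]; positivity, ?_⟩
  filter_upwards [hmem, hσ, hlo, hhi, eventually_ge_atTop (2 : ℝ), hsmallu] with y ht he hlo hhi hy2 hsu
  set t := σ y with htdef
  have ht0 : 0 < t := ht.1
  have hy0 : 0 < y := by linarith only [hy2]
  have hlogy : 0 ≤ Real.log y := Real.log_nonneg (by linarith only [hy2])
  obtain ⟨L, hL⟩ : ∃ L : ℝ, L = 1 + Real.log y := ⟨_, rfl⟩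
  have hL1 : 1 ≤ L := by rw [hL]; linarith only [hlogy]
  have hLy : L ≤ y := by
    rw [hL]; have := Real.log_le_sub_one_of_pos hy0; linarith only [this]
  have hLaw := hlaw t ht
  rw [he] at hLaw
  have ht_le : t ≤ 2 / y := by rw [le_div_iff₀ hy0]; linarith only [hhi]
  have ht_ge : 1 / (2 * y) ≤ t := by rw [div_le_iff₀ (by linarith only [hy0])]; linarith only [hlo]
  have htle1 : t ≤ 1 := ht_le.trans (by rw [div_le_one hy0]; exact hy2)
  have hlogt : |Real.log t| ≤ Real.log y + 1 := by
    have hneg : Real.log t ≤ 0 := Real.log_nonpos ht0.le htle1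
    rw [abs_of_nonpos hneg]
    have h1 : Real.log (1 / (2 * y)) ≤ Real.log t := Real.log_le_log (by positivity) ht_ge
    rw [one_div, Real.log_inv, Real.log_mul (by norm_num) hy0.ne'] at h1
    have h2 : Real.log 2 ≤ 1 := by
      have := Real.log_le_sub_one_of_pos (by norm_num : (0:ℝ) < 2); linarith only [this]
    linarith only [h1, h2]
  -- letters (equations only; nothing is substituted into the goal)
  obtain ⟨E, hE⟩ : ∃ E : ℝ, E = y - 1 / t - κ * Real.log t - C := ⟨_, rfl⟩
  obtain ⟨E₄, hE₄⟩ : ∃ E₄ : ℝ, E₄ = E - a * t - b * t ^ 2 := ⟨_, rfl⟩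
  obtain ⟨u, hu⟩ : ∃ u : ℝ, u = (C + κ * Real.log t + E) / y := ⟨_, rfl⟩
  obtain ⟨r, hr⟩ : ∃ r : ℝ, r = Real.log (y * t) - u := ⟨_, rfl⟩
  obtain ⟨u₀, hu₀⟩ : ∃ u₀ : ℝ, u₀ = (C - κ * Real.log y) / y := ⟨_, rfl⟩
  obtain ⟨d, hd⟩ : ∃ d : ℝ, d = u - u₀ := ⟨_, rfl⟩
  obtain ⟨r₃, hr₃⟩ : ∃ r₃ : ℝ, r₃ = r - u ^ 2 / 2 := ⟨_, rfl⟩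
  have ht2 : t ^ 2 ≤ 4 / y ^ 2 := by
    calc t ^ 2 ≤ (2 / y) ^ 2 := pow_le_pow_left₀ ht0.le ht_le 2
      _ = 4 / y ^ 2 := by rw [div_pow]; norm_num
  have ht3 : t ^ 3 ≤ 8 / y ^ 3 := by
    calc t ^ 3 ≤ (2 / y) ^ 3 := pow_le_pow_left₀ ht0.le ht_le 3
      _ = 8 / y ^ 3 := by rw [div_pow]; norm_num
  have hE₄b : |E₄| ≤ 8 * A / y ^ 3 := by
    rw [hE₄, hE]
    calc |y - 1 / t - κ * Real.log t - C - a * t - b * t ^ 2| ≤ A * t ^ 3 := hLaw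
      _ ≤ A * (8 / y ^ 3) := mul_le_mul_of_nonneg_left ht3 hA
      _ = 8 * A / y ^ 3 := by ring
  have hEb : |E| ≤ A₀ / y := by
    have h0 : E = a * t + b * t ^ 2 + E₄ := by rw [hE₄]; ring
    rw [h0, hA₀]
    have h1 : |a * t| ≤ 2 * |a| / y := by
      rw [abs_mul, abs_of_pos ht0]
      calc |a| * t ≤ |a| * (2 / y) := mul_le_mul_of_nonneg_left ht_le (abs_nonneg a)
        _ = 2 * |a| / y := by ring
    have h2 : |b * t ^ 2| ≤ 2 * |b| / y := by
      rw [abs_mul, abs_of_nonneg (pow_nonneg ht0.le 2)]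
      calc |b| * t ^ 2 ≤ |b| * (4 / y ^ 2) := mul_le_mul_of_nonneg_left ht2 (abs_nonneg b)
        _ = 2 * |b| / y * (2 / y) := by field_simp; ring
        _ ≤ 2 * |b| / y := mul_le_of_le_one_right (by positivity) (by rw [div_le_one hy0]; exact hy2)
    have h3 : |E₄| ≤ 2 * A / y := by
      refine hE₄b.trans ?_
      rw [show 8 * A / y ^ 3 = 2 * A / y * (4 / y ^ 2) by field_simp; ring]
      refine mul_le_of_le_one_right (by positivity) ?_
      rw [div_le_one (by positivity)]; nlinarith only [hy2]
    calc |a * t + b * t ^ 2 + E₄| ≤ |a * t| + |b * t ^ 2| + |E₄| := abs_add_three _ _ _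
      _ ≤ 2 * |a| / y + 2 * |b| / y + 2 * A / y := add_le_add (add_le_add h1 h2) h3
      _ = (2 * |a| + 2 * |b| + 2 * A) / y := by ring
  have hEb' : |E| ≤ A₀ := hEb.trans (div_le_self hA₀nn (by linarith only [hy2]))
  have hub : |u| ≤ B * L / y := by
    rw [hu, abs_div, abs_of_pos hy0]
    refine div_le_div_of_nonneg_right ?_ hy0.le
    calc |C + κ * Real.log t + E| ≤ |C| + |κ * Real.log t| + |E| := abs_add_three _ _ _
      _ ≤ |C| + |κ| * (Real.log y + 1) + A₀ := by
          rw [abs_mul]; exact add_le_add (add_le_add le_rfl (mul_le_mul_of_nonneg_left hlogt (abs_nonneg _))) hEb'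
      _ ≤ B * L := by
          rw [hB, hL]
          linarith only [mul_nonneg (abs_nonneg C) hlogy, mul_nonneg hA₀nn hlogy]
  have hu_half : |u| ≤ 1 / 2 := hub.trans (by rw [hL]; exact hsu)
  have hu0b : |u₀| ≤ B * L / y := by
    rw [hu₀, abs_div, abs_of_pos hy0]
    refine div_le_div_of_nonneg_right ?_ hy0.le
    calc |C - κ * Real.log y| ≤ |C| + |κ * Real.log y| := abs_sub _ _
      _ = |C| + |κ| * Real.log y := by rw [abs_mul, abs_of_nonneg hlogy]
      _ ≤ B * L := by
          rw [hB, hL]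
          linarith only [mul_nonneg (abs_nonneg C) hlogy, mul_nonneg hA₀nn hlogy, abs_nonneg C, abs_nonneg κ,
            hA₀nn, hlogy]
  have hinvw : 1 / (y * t) = 1 - u := by
    have : 1 / t = y - C - κ * Real.log t - E := by rw [hE]; ring
    rw [hu, one_div, mul_inv, ← one_div t, this]
    field_simp
    ring
  have hu2 : u ^ 2 ≤ (B * L / y) ^ 2 := by
    rw [← sq_abs u]; exact pow_le_pow_left₀ (abs_nonneg _) hub 2
  have hrb : |r| ≤ 2 * B ^ 2 * L ^ 2 / y ^ 2 := by
    calc |r| = |Real.log (y * t) - u| := by rw [hr]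
      _ ≤ 2 * u ^ 2 := abs_log_sub_le_of_inv_eq hinvw hu_half
      _ ≤ 2 * (B * L / y) ^ 2 := by linarith only [hu2]
      _ = 2 * B ^ 2 * L ^ 2 / y ^ 2 := by rw [div_pow, mul_pow]; ring
  have hr₃b : |r₃| ≤ 2 * B ^ 3 * L ^ 3 / y ^ 3 := by
    have h1 : |u| ^ 3 ≤ (B * L / y) ^ 3 := pow_le_pow_left₀ (abs_nonneg _) hub 3
    calc |r₃| = |Real.log (y * t) - u - u ^ 2 / 2| := by rw [hr₃, hr]
      _ ≤ 2 * |u| ^ 3 := abs_log_sub_sub_le_of_inv_eq hinvw hu_half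
      _ ≤ 2 * (B * L / y) ^ 3 := by linarith only [h1]
      _ = 2 * B ^ 3 * L ^ 3 / y ^ 3 := by rw [div_pow, mul_pow]; ring
  -- d = (κ u + κ r + E)∕y and its bound
  have hdeq : d = (κ * u + κ * r + E) / y := by
    have elogt : Real.log t = -Real.log y + u + r := by
      have := Real.log_mul hy0.ne' ht0.ne'
      rw [hr]; linarith only [this]
    have hyu : y * u = C + κ * Real.log t + E := by rw [hu]; field_simp
    rw [elogt] at hyu
    rw [hd, hu₀]
    field_simp
    linear_combination hyu
  have hdb : |d| ≤ D₁ * L ^ 2 / y ^ 2 := by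
    rw [hdeq, abs_div, abs_of_pos hy0, hD₁]
    have hLL : L ≤ L ^ 2 := by nlinarith only [hL1]
    have h1 : |κ * u| ≤ |κ| * B * L ^ 2 / y := by
      rw [abs_mul]
      calc |κ| * |u| ≤ |κ| * (B * L / y) := mul_le_mul_of_nonneg_left hub (abs_nonneg κ)
        _ = |κ| * B * L / y := by ring
        _ ≤ |κ| * B * L ^ 2 / y := div_le_div_of_nonneg_right (mul_le_mul_of_nonneg_left hLL (by positivity)) hy0.le
    have h2 : |κ * r| ≤ |κ| * B ^ 2 * L ^ 2 / y := by
      rw [abs_mul]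
      calc |κ| * |r| ≤ |κ| * (2 * B ^ 2 * L ^ 2 / y ^ 2) := mul_le_mul_of_nonneg_left hrb (abs_nonneg κ)
        _ = |κ| * B ^ 2 * L ^ 2 / y * (2 / y) := by field_simp
        _ ≤ |κ| * B ^ 2 * L ^ 2 / y := mul_le_of_le_one_right (by positivity) (by rw [div_le_one hy0]; exact hy2)
    have h3 : |E| ≤ A₀ * L ^ 2 / y := by
      refine hEb.trans (div_le_div_of_nonneg_right ?_ hy0.le)
      exact le_mul_of_one_le_right hA₀nn (one_le_pow₀ hL1)
    calc |κ * u + κ * r + E| / y ≤ (|κ * u| + |κ * r| + |E|) / y := div_le_div_of_nonneg_right (abs_add_three _ _ _) hy0.le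
      _ ≤ (|κ| * B * L ^ 2 / y + |κ| * B ^ 2 * L ^ 2 / y + A₀ * L ^ 2 / y) / y :=
          div_le_div_of_nonneg_right (add_le_add (add_le_add h1 h2) h3) hy0.le
      _ = (|κ| * B + |κ| * B ^ 2 + A₀) * L ^ 2 / y ^ 2 := by field_simp
  rw [inverse_fourth_identity (κ := κ) (C := C) (a := a) (b := b) ht0 hy0 hE hu hr hu₀ hd hE₄ hr₃]
  have h1 := inverse_fourth_remainder_le₁ (κ := κ) (a := a) (b := b) hy2 ht0 ht_le hL1 hB0 hD0 hA hub hrb hu0b hdb hE₄b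
  have h2 := inverse_fourth_remainder_le₂ (κ := κ) (a := a) (b := b) hy2 ht0 ht_le hL1 hLy hB0 hD0 hA hub hdb hr₃b
    hE₄b
  have esplit : -(κ ^ 2 * d / y) - κ ^ 2 * r / y - κ * a * t * u / y - κ * b * t ^ 2 / y - κ * E₄ / y - κ * u₀ * d
        - κ * d ^ 2 / 2 - κ * r₃ - a * d / y - a * t * u ^ 2 - b * t * u / y - b * t ^ 2 * u - E₄
      = (-(κ ^ 2 * d / y) - κ ^ 2 * r / y - κ * a * t * u / y - κ * b * t ^ 2 / y - κ * E₄ / y - κ * u₀ * d)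
        + (-(κ * d ^ 2 / 2) - κ * r₃ - a * d / y - a * t * u ^ 2 - b * t * u / y - b * t ^ 2 * u - E₄) := by ring
  rw [esplit]
  refine (abs_add_le _ _).trans ?_
  rw [hL] at h1 h2
  have h12 := add_le_add h1 h2
  refine h12.trans (le_of_eq ?_)
  rw [hK]
  ring

/-! ## The 1∕y² letter is FORCED: a quadratic polynomial in log y that is o(1) vanishes -/

/-- If `e₂·log²y + e₁·log y + e₀ → 0` as `y → ∞` then `e₂ = e₁ = e₀ = 0` (divide by log²y, then by log y; `tendsto_nhds_unique`). [folklore] -/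
theorem quadLog_letters_eq_zero {e₂ e₁ e₀ : ℝ}
    (h : Tendsto (fun y : ℝ => e₂ * Real.log y ^ 2 + e₁ * Real.log y + e₀) atTop (𝓝 0)) :
    e₂ = 0 ∧ e₁ = 0 ∧ e₀ = 0 := by
  have hlog : Tendsto (fun y : ℝ => Real.log y) atTop atTop := Real.tendsto_log_atTop
  have hinv : Tendsto (fun y : ℝ => (Real.log y)⁻¹) atTop (𝓝 0) := hlog.inv_tendsto_atTop
  have hinv2 : Tendsto (fun y : ℝ => (Real.log y)⁻¹ ^ 2) atTop (𝓝 0) := by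
    have := hinv.pow 2; rwa [zero_pow two_ne_zero] at this
  have hpos : ∀ᶠ y : ℝ in atTop, 0 < Real.log y := hlog.eventually (eventually_gt_atTop 0)
  -- e₂ = 0: divide by log²y
  have he₂ : e₂ = 0 := by
    have h1 : Tendsto (fun y : ℝ => (e₂ * Real.log y ^ 2 + e₁ * Real.log y + e₀) * (Real.log y)⁻¹ ^ 2) atTop (𝓝 (0 * 0)) :=
      h.mul hinv2
    rw [mul_zero] at h1
    have h2 : Tendsto (fun y : ℝ => e₂ + e₁ * (Real.log y)⁻¹ + e₀ * (Real.log y)⁻¹ ^ 2) atTop (𝓝 (e₂ + e₁ * 0 + e₀ * 0)) :=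
      (tendsto_const_nhds.add (hinv.const_mul e₁)).add (hinv2.const_mul e₀)
    rw [mul_zero, mul_zero, add_zero, add_zero] at h2
    have h3 : ∀ᶠ y : ℝ in atTop, (e₂ * Real.log y ^ 2 + e₁ * Real.log y + e₀) * (Real.log y)⁻¹ ^ 2
        = e₂ + e₁ * (Real.log y)⁻¹ + e₀ * (Real.log y)⁻¹ ^ 2 := by
      filter_upwards [hpos] with y hy
      field_simp
    exact tendsto_nhds_unique (h2.congr' (h3.mono fun y hy => hy.symm)) h1
  subst he₂
  -- e₁ = 0: divide by log y
  have he₁ : e₁ = 0 := by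
    have h1 : Tendsto (fun y : ℝ => (0 * Real.log y ^ 2 + e₁ * Real.log y + e₀) * (Real.log y)⁻¹) atTop (𝓝 (0 * 0)) :=
      h.mul hinv
    rw [mul_zero] at h1
    have h2 : Tendsto (fun y : ℝ => e₁ + e₀ * (Real.log y)⁻¹) atTop (𝓝 (e₁ + e₀ * 0)) :=
      tendsto_const_nhds.add (hinv.const_mul e₀)
    rw [mul_zero, add_zero] at h2
    have h3 : ∀ᶠ y : ℝ in atTop, (0 * Real.log y ^ 2 + e₁ * Real.log y + e₀) * (Real.log y)⁻¹ = e₁ + e₀ * (Real.log y)⁻¹ := by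
      filter_upwards [hpos] with y hy
      field_simp
      ring
    exact tendsto_nhds_unique (h2.congr' (h3.mono fun y hy => hy.symm)) h1
  subst he₁
  have h0 : Tendsto (fun _ : ℝ => e₀) atTop (𝓝 0) := by
    refine h.congr' (Eventually.of_forall fun y => ?_)
    ring
  exact ⟨rfl, rfl, tendsto_nhds_unique tendsto_const_nhds h0⟩

/-- **THE 1∕y² LETTER IS UNIQUE** ([folklore]): if a real function G satisfies eventually
`|G y − (p₂·log²y + p₁·log y + p₀)∕y²| ≤ A·(1 + log y)³∕y³` and the same with letters p₂′, p₁′, p₀′ and A′, then the letters agree —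
so the polynomial Q of `inverse_law_fourth` is FORCED by the running coupling (apply with
`G y := 1∕σ y − y − κ·log y + C − κ²·(log y)∕y + (κC + a)∕y`). -/
theorem invLetter2_unique {G : ℝ → ℝ} {p₂ p₁ p₀ p₂' p₁' p₀' A A' : ℝ}
    (h : ∀ᶠ y in atTop, |G y - (p₂ * Real.log y ^ 2 + p₁ * Real.log y + p₀) / y ^ 2| ≤ A * (1 + Real.log y) ^ 3 / y ^ 3)
    (h' : ∀ᶠ y in atTop, |G y - (p₂' * Real.log y ^ 2 + p₁' * Real.log y + p₀') / y ^ 2| ≤ A' * (1 + Real.log y) ^ 3 / y ^ 3) :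
    p₂ = p₂' ∧ p₁ = p₁' ∧ p₀ = p₀' := by
  -- the difference polynomial is bounded by (A + A′)(1 + log y)³∕y → 0
  have hw : Tendsto (fun y : ℝ => (1 + Real.log y) ^ 3 / y) atTop (𝓝 0) := by
    have hl0 : Tendsto (fun y : ℝ => 1 / y) atTop (𝓝 0) := tendsto_const_nhds.div_atTop tendsto_id
    have hl1 : Tendsto (fun y : ℝ => Real.log y / y) atTop (𝓝 0) := Real.isLittleO_log_id_atTop.tendsto_div_nhds_zero
    have hl2 : Tendsto (fun y : ℝ => Real.log y ^ 2 / y) atTop (𝓝 0) := by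
      have := Real.tendsto_pow_log_div_mul_add_atTop 1 0 2 one_ne_zero; simpa using this
    have hl3 : Tendsto (fun y : ℝ => Real.log y ^ 3 / y) atTop (𝓝 0) := by
      have := Real.tendsto_pow_log_div_mul_add_atTop 1 0 3 one_ne_zero; simpa using this
    have hs := ((hl0.add (hl1.const_mul 3)).add (hl2.const_mul 3)).add hl3
    simp only [mul_zero, add_zero] at hs
    refine hs.congr' ?_
    filter_upwards [eventually_gt_atTop (0 : ℝ)] with y hy
    field_simp
    ring
  have hev : ∀ᶠ y in atTop, |(p₂ - p₂') * Real.log y ^ 2 + (p₁ - p₁') * Real.log y + (p₀ - p₀')|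
      ≤ (A + A') * ((1 + Real.log y) ^ 3 / y) := by
    filter_upwards [h, h', eventually_gt_atTop (0 : ℝ)] with y hy hy' hy0
    have e : (p₂ - p₂') * Real.log y ^ 2 + (p₁ - p₁') * Real.log y + (p₀ - p₀')
        = y ^ 2 * ((G y - (p₂' * Real.log y ^ 2 + p₁' * Real.log y + p₀') / y ^ 2)
          - (G y - (p₂ * Real.log y ^ 2 + p₁ * Real.log y + p₀) / y ^ 2)) := by
      field_simp; ring
    rw [e, abs_mul, abs_of_pos (by positivity : (0:ℝ) < y ^ 2)]
    calc y ^ 2 * |(G y - (p₂' * Real.log y ^ 2 + p₁' * Real.log y + p₀') / y ^ 2)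
          - (G y - (p₂ * Real.log y ^ 2 + p₁ * Real.log y + p₀) / y ^ 2)|
        ≤ y ^ 2 * (A' * (1 + Real.log y) ^ 3 / y ^ 3 + A * (1 + Real.log y) ^ 3 / y ^ 3) :=
          mul_le_mul_of_nonneg_left ((abs_sub _ _).trans (add_le_add hy' hy)) (by positivity)
      _ = (A + A') * ((1 + Real.log y) ^ 3 / y) := by field_simp; ring
  have hR : Tendsto (fun y : ℝ => (A + A') * ((1 + Real.log y) ^ 3 / y)) atTop (𝓝 ((A + A') * 0)) := hw.const_mul _
  rw [mul_zero] at hR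
  have hz : Tendsto (fun y : ℝ => (p₂ - p₂') * Real.log y ^ 2 + (p₁ - p₁') * Real.log y + (p₀ - p₀')) atTop (𝓝 0) :=
    squeeze_zero_norm' (by simpa only [Real.norm_eq_abs] using hev) hR
  obtain ⟨h2, h1, h0⟩ := quadLog_letters_eq_zero hz
  exact ⟨by linarith, by linarith, by linarith⟩

end

end Summit.QuantumFields.BalabanUV.Beta.EriceFlowEnclosureInverseLawFourth
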